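/-
Literature/NumberTheory/NumberFields/VanishingSumsRootsOfUnityPrimePowers.lean — pub-hodgecm2 (COR-CM), KEPT Literature lane lit-deligne-3
gen 66, file F66b.  THEOREMS ONLY (no `def`, no named fact, no `sorry`, no instance, no notation; D-0026 net debt 0).  HC_CM is NOT proved.
-/
import Literature.NumberTheory.NumberFields.VanishingSumsRootsOfUnitySquarefree
import HarnessLib

/-!
# Vanishing sums of roots of unity of ARBITRARY order `n = Π p_i^{a_i+1}`: linear disjointness of `ℚ(ζ_{p^{a+1}})` and `ℚ(ζ_m)` (`p ∤ m`) in
# PERIODIC form, and the criterion «`Σ_x f(x) Π μ_i^{x_i} = 0` ⟺ all `k`-th mixed differences of `f` along the subgroups of order `p_i`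
# vanish» (Rédei ∕ de Bruijn ∕ Schoenberg; [LamLeung2000] Thm. 2.2 for every conductor, rational coefficients)

Topic `Literature/NumberTheory/NumberFields` (namespace `Literature.NumberTheory.NumberFields.VanishingSumsPrimePowers`); cell `pub-hodgecm2`
(COR-CM), KEPT Literature lane `lit-deligne-3` gen 66, file F66b — the `TODO(general form)` of the neighbour `VanishingSumsRootsOfUnitySquarefree`
(F65d, squarefree conductor): prime powers `p^{a+1} ∥ n`, i.e. the relation theorem for ALL conductors, the arithmetic input of the kernel decisions
at index `2n`, `n` odd ARBITRARY, in Kubota's rank count (the lane's prime-power files `…CyclicPrimePower`, `…IndexFourMulPrimePower` are the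
one-prime case, F65d the squarefree case).  Mathlib, F65d §1 (`isPrimitiveRoot_mul_of_coprime`, `mem_adjoin_mul_of_coprime_left ∕ _right`,
`finrank_adjoin_pair`) and the tree's `CyclotomicGaussianIndependence.finrank_adjoin_eq_totient` only.  KERNEL ONLY: theorems; no `def`, no named
fact, no instance, no notation (D-0014 ∕ D-0026 net debt `0`).  HC_CM is NOT proved here or anywhere in the lane (nothing here concerns Hodge classes).

## Mathematics

Let `G = ⟨g⟩` be cyclic of order `n = p₁^{a₁+1}⋯p_k^{a_k+1}` and `φ : ℤG → ℤ[ζ_n]` the natural map.  [LamLeung2000, Thm. 2.2] (Rédei, Hilfssatz 4;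
de Bruijn, Thm. 1; Schoenberg, Thm. 1): `ker φ = Σ_{i=1}^k ℤG · σ(P_i)`, `P_i` the subgroup of order `p_i`, `σ(P_i) = Σ_{h ∈ P_i} h` — for EVERY `n`,
squarefree or not.  The proof is an induction on `k` whose step is the LINEAR DISJOINTNESS of `ℚ(ζ_{p^{a+1}})` and `ℚ(ζ_m)` for `p ∤ m`:
`[ℚ(ζ_{p^{a+1}m}) : ℚ] = φ(p^{a+1})φ(m)` [Washington1997, Thm. 2.5], so `Φ_{p^{a+1}}(X) = Φ_p(X^{p^a}) = Σ_{j<p} X^{jp^a}` stays irreducible over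
`ℚ(ζ_m)`, and a `ℚ(ζ_m)`-combination `Σ_{x ∈ ℤ/p^{a+1}} c_x μ^x` of the powers of a primitive `p^{a+1}`-th root `μ` vanishes iff the polynomial
`Σ c_x X^x` (degree `< p^{a+1}`) is `Φ_{p^{a+1}} · Q` with `deg Q < p^a`, i.e. iff `c` is `p^a`-PERIODIC: `c_{x + p^a} = c_x` — constant on the cosets
of the subgroup `P = p^aℤ/p^{a+1}ℤ` of order `p`.

With `G ≅ Π_i ℤ/p_i^{a_i+1}` (CRT) the theorem takes the LOCAL form used by the CM-type kernel decisions: a rational `f` on `Π_i ℤ/p_i^{a_i+1}` is a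
relation `Σ_x f(x) Π_i μ_i^{x_i} = 0` (`μ_i` primitive `p_i^{a_i+1}`-th roots; `Π μ_i^{x_i}` runs through all `n`-th roots of unity) iff EVERY `k`-TH MIXED
DIFFERENCE OF `f` ALONG THE SUBGROUPS `P_i` VANISHES:

  `Σ_{ε ∈ {0,1}^k} (−1)^{|ε|} f(x + ε·d) = 0`   for all base points `x` and all displacements `d` with `p_i · d_i = 0` (`d_i ∈ P_i`),

(`k = 1`: `f` constant on `P`-cosets — the tree's `PrimePow.sum_mul_pow_eq_zero_iff_periodic` over `ℚ`; all `a_i = 0`: the neighbour's squarefree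
criterion, where `d` is unrestricted).  This file proves it by the induction of loc. cit.: split off the first coordinate, `Σ_x f(x) Π μ_i^{x_i} = Σ_b c_b μ₁^b`
with `c_b ∈ ℚ(μ₂⋯μ_k) = ℚ(ζ_{n/p₁^{a₁+1}})`; by linear disjointness the outer sum vanishes iff `b ↦ c_b` is constant on `P₁`-cosets, i.e. iff every ROW
DIFFERENCE `f(b + d₁, ·) − f(b, ·)` (`d₁ ∈ P₁`) is a relation in `k − 1` variables; and the `k`-th mixed differences of `f` are the `(k−1)`-th mixed
differences of its row differences.

* §1 LINEAR DISJOINTNESS FOR A PRIME POWER (`p` prime, `p ∤ m`, `μ` primitive `p^{a+1}`-th, `ν` primitive `m`-th root): **`natDegree_minpoly_adjoin_eq_totient`**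
  (`[ℚ(ζ_m)(μ) : ℚ(ζ_m)] = φ(p^{a+1})`, tower law via Mathlib's `relfinrank`), **`cyclotomic_primePow_eq_minpoly_adjoin`** (`Φ_{p^{a+1}}` is the minimal
  polynomial of `μ` over `ℚ(ζ_m)`), `sum_mul_pow_eq_zero_of_periodic` (a `p^a`-periodic vector is a relation: the sum `T` satisfies `T·μ^{p^a} = T`),
  **`periodic_of_sum_mul_pow_eq_zero`** (a relation with coefficients in `ℚ(ζ_m)` is `p^a`-periodic: `P = Φ_{p^{a+1}}·Q`, `deg Q < p^a`, and the
  coefficient of `X^{r + jp^a}` in `(Σ_{i<p} X^{ip^a})·Q` is `Q_r`), **`sum_mul_pow_eq_zero_iff_periodic`**, private `exists_eq_nsmul_of_smul_eq_zero_pp` (`p·d = 0`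
  in `ℤ/p^{a+1}` ⟹ `d ∈ ℕ·p^a`), **`sum_mul_pow_eq_zero_iff_forall_smul_eq_zero`** (relation ⟺ `c(x + d) = c(x)` for all
  `d` with `p·d = 0`).
* §2 FAMILIES of prime powers with pairwise distinct primes: `isPrimitiveRoot_prod` (`Π μ_i` is a primitive `Π p_i^{a_i+1}`-th root), `mem_adjoin_prod`
  (`μ_j ∈ ℚ(Π μ_i)`).
* §3 THE CRITERION: private `alternatingSum_cons_pp` (splitting the alternating sum along the first coordinate),
  **`sum_mul_prod_pow_eq_zero_iff_forall_alternatingSum_eq_zero`** (statement above; tuples as `Π i : Fin k, ZMod (p i ^ (a i + 1))`, admissible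
  displacements `p i • d i = 0`, signs as `Π_i (if ε_i then −1 else 1)`, coefficients through `algebraMap ℚ ℂ`).
-- TODO(generator form): `f = Σ_i F_i` with `F_i` invariant under `P_i`-translation in the `i`-th coordinate (the neighbour's §5 for squarefree `n`);
-- not needed by the kernel decisions, which consume the mixed-difference form.

PRESEARCH (lane rule): corpus keyword «vanishing sums of roots of unity» → [corpus: paper:arxiv-math_9511209 = LamLeung2000, chunks p0034 (Thm. 2.2,
stated for arbitrary `m = p₁^{a₁}⋯p_r^{a_r}` with the Rédei ∕ de Bruijn ∕ Schoenberg attributions) and p0062 (Thm. 3.3, linear disjointness)] (read by the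
lane in gen 65, addendum 279); corpus hybrid «linear relations among roots of unity prime power periodic de Bruijn Rédei Schoenberg» and galaxy «vanishing
sums of roots of unity | de Bruijn | Schoenberg» (gen 65 queries, all stars): no Lean-ready statement beyond loc. cit.; the periodic ∕ mixed-difference
LOCAL form is recorded as the lane's own elementary reformulation with [LamLeung2000] Thm. 2.2 ∕ 3.3 and [ConwayJones1976] Thm. 1 cited for the printed
theorem.

HONEST REGISTER.  Unconditional and elementary (Mathlib's cyclotomic degree formula and `cyclotomic_prime_pow_eq_geom_sum`, the tower law, coefficient
comparison).  Rational coefficients only (the ℤ- and ℕ-coefficient refinements of loc. cit. — minimal vanishing sums, Thm. 3.3, the weight theorem 5.2 —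
are NOT claimed).  Nothing here bears on Hodge classes; HC_CM is NOT proved and not used.

## References

* [LamLeung2000] T. Y. Lam, K. H. Leung, *On vanishing sums of roots of unity*, J. Algebra 224 (2000) 91–109 (arXiv:math/9511209): Thm. 2.2
  (cf. L. Rédei, Hilfssatz 4; N. G. de Bruijn, *On the factorisation of cyclic groups* (1953), Thm. 1; I. J. Schoenberg (1964), Thm. 1), Thm. 3.3
  and its proof (linear disjointness).
* [ConwayJones1976] J. H. Conway, A. J. Jones, *Trigonometric diophantine equations (On vanishing sums of roots of unity)*, Acta Arith. 30
  (1976) 229–240, Thm. 1.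
* [Washington1997] L. C. Washington, *Introduction to Cyclotomic Fields*, 2nd ed., GTM 83, Ch. 2: Prop. 2.4, Thm. 2.5.
* [Hazama2003CyclicCM] F. Hazama, J. Math. Sci. Univ. Tokyo 10 (2003), Prop. 4.3 (proof, (4.4)–(4.5): the one-prime-power case over `ℚ`).

## Provenance

Cell `pub-hodgecm2` (COR-CM), KEPT Literature lane `lit-deligne-3` gen 66 (claim VANISHING-SUMS-PRIME-POWERS; count-neutral, own lane), file F66b;
neighbours cited by name, nothing restated: `VanishingSumsRootsOfUnitySquarefree` (F65d §1, imported), `CyclotomicGaussianIndependence`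
(`finrank_adjoin_eq_totient`), `DegenerateCMTypesCyclicPrimePower` (`PrimePow.sum_mul_pow_eq_zero_iff_periodic`, the case `m = 1` over `ℚ`, not
imported).  The `[folklore]` helpers are private (suffix `_pp`).  Theorems only; net Literature debt 0.
-/

noncomputable section

open scoped BigOperators
open Polynomial IntermediateField

namespace Literature.NumberTheory.NumberFields.VanishingSumsPrimePowers

open Literature.NumberTheory.NumberFields.CyclotomicGaussian (finrank_adjoin_eq_totient)
open Literature.NumberTheory.NumberFields.VanishingSumsSquarefree (isPrimitiveRoot_mul_of_coprime mem_adjoin_mul_of_coprime_left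
  mem_adjoin_mul_of_coprime_right finrank_adjoin_pair)

/-! ## §1 Linear disjointness for a prime power: `Φ_{p^{a+1}}` stays irreducible over `ℚ(ζ_m)` (`p ∤ m`), and the `ℚ(ζ_m)`-relations among
`1, μ, …, μ^{p^{a+1}−1}` are the `p^a`-PERIODIC coefficient vectors -/

section Disjoint

variable {p m a : ℕ} {μ ν : ℂ}

/-- **`[ℚ(ζ_m)(μ) : ℚ(ζ_m)] = φ(p^{a+1})`** for a primitive `p^{a+1}`-th root of unity `μ` and a primitive `m`-th root `ν`, `p ∤ m`
(`[ℚ(ζ_{p^{a+1}m}) : ℚ] = φ(p^{a+1})φ(m)` and the tower law). [cite: Washington1997, Ch. 2 Prop. 2.4 and Thm. 2.5]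
[cite: LamLeung2000, proof of Thm. 3.3 («linearly disjoint, by a theorem of Kronecker»)] -/
theorem natDegree_minpoly_adjoin_eq_totient [hp : Fact p.Prime] (hm : 0 < m) (hpm : p.Coprime m) (hμ : IsPrimitiveRoot μ (p ^ (a + 1)))
    (hν : IsPrimitiveRoot ν m) : (minpoly ℚ⟮ν⟯ μ).natDegree = (p ^ (a + 1)).totient := by
  have hq0 : 0 < p ^ (a + 1) := pow_pos hp.out.pos _
  have hcop : (p ^ (a + 1)).Coprime m := Nat.Coprime.pow_left _ hpm
  have hνint : IsIntegral ℚ ν := (hν.isIntegral hm).tower_top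
  have hμint : IsIntegral ℚ μ := (hμ.isIntegral hq0).tower_top
  haveI : FiniteDimensional ℚ ℚ⟮ν⟯ := adjoin.finiteDimensional hνint
  haveI : FiniteDimensional ℚ ℚ⟮ν, μ⟯ := finiteDimensional_adjoin_pair hνint hμint
  have hFE : ℚ⟮ν⟯ ≤ ℚ⟮ν, μ⟯ := adjoin.mono ℚ _ _ (Set.singleton_subset_iff.mpr (Set.mem_insert _ _))
  have hE : Module.finrank ℚ ℚ⟮ν, μ⟯ = Nat.totient m * (p ^ (a + 1)).totient := by
    rw [finrank_adjoin_pair hm hq0 hcop.symm hν hμ]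
  have h1 := finrank_bot_mul_relfinrank hFE
  rw [relfinrank_eq_finrank_of_le hFE, finrank_adjoin_eq_totient hm hν, hE] at h1
  have hdeg : Module.finrank ℚ⟮ν⟯ (extendScalars hFE) = (p ^ (a + 1)).totient :=
    Nat.eq_of_mul_eq_mul_left (Nat.totient_pos.mpr hm) h1
  have hKE : ℚ⟮ν⟯⟮μ⟯ = extendScalars hFE := by
    apply IntermediateField.restrictScalars_injective ℚ
    exact (adjoin_simple_adjoin_simple ℚ ν μ).trans (extendScalars_restrictScalars hFE).symm
  rw [← adjoin.finrank (hμint.tower_top (A := ℚ⟮ν⟯)), hKE, hdeg]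

/-- **`Φ_{p^{a+1}}` is the minimal polynomial of `μ` over `ℚ(ζ_m)`** (`p ∤ m`): irreducibility of the `p^{a+1}`-th cyclotomic polynomial over a
cyclotomic field of conductor prime to `p`. [cite: Washington1997, Ch. 2 Prop. 2.4 and Thm. 2.5] -/
theorem cyclotomic_primePow_eq_minpoly_adjoin [hp : Fact p.Prime] (hm : 0 < m) (hpm : p.Coprime m) (hμ : IsPrimitiveRoot μ (p ^ (a + 1)))
    (hν : IsPrimitiveRoot ν m) : cyclotomic (p ^ (a + 1)) ℚ⟮ν⟯ = minpoly ℚ⟮ν⟯ μ := by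
  have hq0 : 0 < p ^ (a + 1) := pow_pos hp.out.pos _
  have hμint : IsIntegral ℚ⟮ν⟯ μ := ((hμ.isIntegral hq0).tower_top (A := ℚ)).tower_top
  refine eq_of_monic_of_dvd_of_natDegree_le (minpoly.monic hμint) (cyclotomic.monic _ _) (minpoly.dvd _ μ ?_) ?_
  · rw [aeval_def, eval₂_eq_eval_map, map_cyclotomic, ← IsRoot.def, isRoot_cyclotomic_iff]
    exact hμ
  · rw [natDegree_cyclotomic, natDegree_minpoly_adjoin_eq_totient hm hpm hμ hν]

/-- `μ^{(x + t).val} = μ^{x.val} · μᵗ` for `μ` of order `n` and `t ∈ ℕ`. [folklore] -/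
private theorem pow_val_add_natCast_pp {n : ℕ} [NeZero n] (hμ : IsPrimitiveRoot μ n) (x : ZMod n) (t : ℕ) :
    μ ^ (x + (t : ZMod n)).val = μ ^ x.val * μ ^ t := by
  have h1 := pow_mod_orderOf μ (x.val + t % n)
  have h2 := pow_mod_orderOf μ t
  rw [← hμ.eq_orderOf] at h1 h2
  rw [ZMod.val_add, ZMod.val_natCast, h1, pow_add, h2]

/-- **A `p^a`-periodic coefficient vector is a relation**: if `c(x + p^a) = c(x)` for all `x ∈ ℤ/p^{a+1}` then `Σ_x c_x μ^x = 0` for every primitive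
`p^{a+1}`-th root of unity `μ` (the sum `T` satisfies `T = μ^{p^a}·T` by the shift `x ↦ x + p^a`, and `μ^{p^a} ≠ 1`); equivalently `Σ_x c_x μ^x` is a
combination of the rotated `p`-gons `μ^r(1 + μ^{p^a} + ⋯ + μ^{(p−1)p^a}) = 0`. [cite: LamLeung2000, Thm. 2.2 (the inclusion `⊇`: `σ(P_i) ∈ ker φ`)] -/
theorem sum_mul_pow_eq_zero_of_periodic [hp : Fact p.Prime] (hμ : IsPrimitiveRoot μ (p ^ (a + 1))) (c : ZMod (p ^ (a + 1)) → ℂ)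
    (hper : ∀ x, c (x + (p ^ a : ℕ)) = c x) : ∑ x : ZMod (p ^ (a + 1)), c x * μ ^ x.val = 0 := by
  have hp1 : 1 < p := hp.out.one_lt
  have hta : p ^ a < p ^ (a + 1) := Nat.pow_lt_pow_right hp1 (Nat.lt_succ_self a)
  have hμt : μ ^ (p ^ a) ≠ 1 := hμ.pow_ne_one_of_pos_of_lt (pow_pos hp.out.pos _).ne' hta
  set T := ∑ x : ZMod (p ^ (a + 1)), c x * μ ^ x.val with hT
  have hre : ∑ x : ZMod (p ^ (a + 1)), c (x + (p ^ a : ℕ)) * μ ^ (x + ((p ^ a : ℕ) : ZMod (p ^ (a + 1)))).val = T :=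
    Fintype.sum_equiv (Equiv.addRight ((p ^ a : ℕ) : ZMod (p ^ (a + 1)))) _ _ fun x => rfl
  have hre' : ∑ x : ZMod (p ^ (a + 1)), c (x + (p ^ a : ℕ)) * μ ^ (x + ((p ^ a : ℕ) : ZMod (p ^ (a + 1)))).val = T * μ ^ (p ^ a) := by
    rw [hT, Finset.sum_mul]
    refine Finset.sum_congr rfl fun x _ => ?_
    rw [hper, pow_val_add_natCast_pp hμ, mul_assoc]
  have hTT : T * (μ ^ (p ^ a) - 1) = 0 := by rw [mul_sub, mul_one, ← hre', hre, sub_self]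
  rcases mul_eq_zero.1 hTT with h | h
  · exact h
  · exact absurd (sub_eq_zero.1 h) hμt

/-- Reindex a sum over `ZMod n` by the representatives `0, …, n − 1`. [folklore] -/
private theorem sum_zmod_eq_sum_range_pp {M : Type*} [AddCommMonoid M] {n : ℕ} [NeZero n] (f : ℕ → M) :
    ∑ k : ZMod n, f k.val = ∑ k ∈ Finset.range n, f k := by
  refine Finset.sum_nbij' (fun k => k.val) (fun k => (k : ZMod n)) ?_ ?_ ?_ ?_ ?_
  · intro k _; exact Finset.mem_range.2 (ZMod.val_lt k)
  · intro k _; exact Finset.mem_univ _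
  · intro k _; exact ZMod.natCast_zmod_val k
  · intro k hk; exact ZMod.val_cast_of_lt (Finset.mem_range.1 hk)
  · intro k _; rfl

/-- **Linear disjointness of `ℚ(ζ_{p^{a+1}})` and `ℚ(ζ_m)` (`p` prime, `p ∤ m`), periodic form**: if `Σ_{x ∈ ℤ/p^{a+1}} c_x μˣ = 0` with
coefficients `c_x ∈ ℚ(ν)` (`μ` a primitive `p^{a+1}`-th, `ν` a primitive `m`-th root of unity), then `c` is `p^a`-PERIODIC: `c(x + p^a) = c(x)` — the
`ℚ(ζ_m)`-relations among the `p^{a+1}`-th roots of unity are spanned by the coset sums of the subgroup of order `p`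
(`Φ_{p^{a+1}}(X) = Φ_p(X^{p^a})`: write `P = Σ c_x X^x = Φ_{p^{a+1}}·Q` with `deg Q < p^a` and compare coefficients).  The case `a = 0` is the
neighbour's `VanishingSumsSquarefree.forall_eq_of_sum_mul_pow_eq_zero`; the case `m = 1` is the tree's `PrimePow.sum_mul_pow_eq_zero_iff_periodic`.
[cite: LamLeung2000, Thm. 2.2 and proof of Thm. 3.3] [cite: Washington1997, Ch. 2 Prop. 2.4] [cite: Hazama2003CyclicCM, Prop. 4.3 (proof, (4.4)–(4.5))] -/
theorem periodic_of_sum_mul_pow_eq_zero [hp : Fact p.Prime] (hm : 0 < m) (hpm : p.Coprime m) (hμ : IsPrimitiveRoot μ (p ^ (a + 1)))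
    (hν : IsPrimitiveRoot ν m) (c : ZMod (p ^ (a + 1)) → ℂ) (hc : ∀ x, c x ∈ ℚ⟮ν⟯) (h : ∑ x : ZMod (p ^ (a + 1)), c x * μ ^ x.val = 0)
    (x : ZMod (p ^ (a + 1))) : c (x + (p ^ a : ℕ)) = c x := by
  have hp1 : 1 < p := hp.out.one_lt
  have ht0 : 0 < p ^ a := pow_pos hp.out.pos _
  have hq : p ^ (a + 1) = p ^ a * p := pow_succ p a
  have hta : p ^ a < p ^ (a + 1) := Nat.pow_lt_pow_right hp1 (Nat.lt_succ_self a)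
  -- the polynomial `P = Σ_x c_x X^x ∈ ℚ(ν)[X]` vanishes at `μ`
  set c' : ZMod (p ^ (a + 1)) → ℚ⟮ν⟯ := fun y => ⟨c y, hc y⟩ with hc'
  set P : (ℚ⟮ν⟯)[X] := ∑ y : ZMod (p ^ (a + 1)), C (c' y) * X ^ y.val with hP
  have hPμ : aeval μ P = 0 := by
    rw [hP, map_sum]
    simp only [map_mul, aeval_C, map_pow, aeval_X]
    exact h
  -- so `P = Φ_{p^{a+1}} · Q`
  have hdvd : cyclotomic (p ^ (a + 1)) ℚ⟮ν⟯ ∣ P := by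
    rw [cyclotomic_primePow_eq_minpoly_adjoin hm hpm hμ hν]
    exact minpoly.dvd _ μ hPμ
  obtain ⟨Q, hQ⟩ := hdvd
  have hdegΦ : (cyclotomic (p ^ (a + 1)) ℚ⟮ν⟯).natDegree = p ^ a * (p - 1) := by
    rw [natDegree_cyclotomic, Nat.totient_prime_pow_succ hp.out]
  have hdegP : P.natDegree ≤ p ^ (a + 1) - 1 := by
    rw [hP]
    refine natDegree_sum_le_of_forall_le _ _ fun y _ => ?_
    exact (natDegree_C_mul_X_pow_le (c' y) y.val).trans (by have := ZMod.val_lt y; omega)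
  -- `Q` has degree `< p^a`
  have hQcoef : ∀ k : ℕ, p ^ a ≤ k → Q.coeff k = 0 := by
    intro k hk
    by_cases hQ0 : Q = 0
    · rw [hQ0, coeff_zero]
    · apply coeff_eq_zero_of_natDegree_lt
      have hdeg := hdegP
      rw [hQ, natDegree_mul (cyclotomic_ne_zero _ _) hQ0, hdegΦ] at hdeg
      have h2 : p ^ a * (p - 1) + p ^ a = p ^ (a + 1) := by
        rw [hq, ← Nat.mul_succ, Nat.succ_eq_add_one, Nat.sub_add_cancel hp1.le]
      omega
  -- the coefficients of `P`
  have hcoefP : ∀ k : ℕ, k < p ^ (a + 1) → P.coeff k = c' (k : ZMod (p ^ (a + 1))) := by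
    intro k hk
    rw [hP, finsetSum_coeff]
    simp_rw [coeff_C_mul_X_pow]
    rw [Finset.sum_eq_single (k : ZMod (p ^ (a + 1)))]
    · rw [if_pos (ZMod.val_cast_of_lt hk).symm]
    · intro j _ hj
      rw [if_neg]
      intro hkj
      apply hj
      rw [hkj, ZMod.natCast_zmod_val]
    · intro hk'; exact absurd (Finset.mem_univ _) hk'
  -- the coefficients of `Φ_{p^{a+1}} · Q = Σ_{i<p} X^{p^a i} · Q`: at `r + p^a j` (`r < p^a`, `j < p`) one reads `Q_r`
  have hprod : ∀ r j : ℕ, r < p ^ a → j < p → (cyclotomic (p ^ (a + 1)) ℚ⟮ν⟯ * Q).coeff (r + p ^ a * j) = Q.coeff r := by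
    intro r j hr hj
    rw [cyclotomic_prime_pow_eq_geom_sum hp.out, Finset.sum_mul, finsetSum_coeff]
    simp_rw [← pow_mul, coeff_X_pow_mul']
    rw [Finset.sum_eq_single j]
    · rw [if_pos (Nat.le_add_left _ _), Nat.add_sub_cancel]
    · intro i _ hij
      split_ifs with hle
      · apply hQcoef
        rcases lt_or_gt_of_ne hij with hlt | hgt
        · have h1 : p ^ a * i + p ^ a ≤ p ^ a * j := by
            rw [← Nat.mul_succ]; exact Nat.mul_le_mul_left _ (Nat.succ_le_of_lt hlt)
          omega
        · have h1 : p ^ a * j + p ^ a ≤ p ^ a * i := by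
            rw [← Nat.mul_succ]; exact Nat.mul_le_mul_left _ (Nat.succ_le_of_lt hgt)
          omega
      · rfl
    · intro hj'; exact absurd (Finset.mem_range.2 hj) hj'
  -- hence `c'_y = Q_{y mod p^a}` for every `y`
  have hval : ∀ y : ZMod (p ^ (a + 1)), c' y = Q.coeff (y.val % p ^ a) := by
    intro y
    have hy := ZMod.val_lt y
    have hdiv : y.val / p ^ a < p := Nat.div_lt_of_lt_mul (by rwa [← hq])
    rw [← hprod (y.val % p ^ a) (y.val / p ^ a) (Nat.mod_lt _ ht0) hdiv, Nat.mod_add_div, ← hQ, hcoefP _ hy,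
      ZMod.natCast_zmod_val]
  -- and `(x + p^a) mod p^a = x mod p^a`
  have hmod : (x + ((p ^ a : ℕ) : ZMod (p ^ (a + 1)))).val % p ^ a = x.val % p ^ a := by
    rw [ZMod.val_add, ZMod.val_natCast, Nat.mod_eq_of_lt hta, Nat.mod_mod_of_dvd _ (pow_dvd_pow p (Nat.le_succ a)),
      Nat.add_mod_right]
  have key : c' (x + (p ^ a : ℕ)) = c' x := by rw [hval, hval, hmod]
  exact congrArg Subtype.val key

/-- **The `ℚ(ζ_m)`-relations among the `p^{a+1}`-th roots of unity are exactly the `p^a`-periodic coefficient vectors** (`p ∤ m`).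
[cite: LamLeung2000, Thm. 2.2] [cite: Washington1997, Ch. 2 Prop. 2.4] -/
theorem sum_mul_pow_eq_zero_iff_periodic [hp : Fact p.Prime] (hm : 0 < m) (hpm : p.Coprime m) (hμ : IsPrimitiveRoot μ (p ^ (a + 1)))
    (hν : IsPrimitiveRoot ν m) (c : ZMod (p ^ (a + 1)) → ℂ) (hc : ∀ x, c x ∈ ℚ⟮ν⟯) :
    ∑ x : ZMod (p ^ (a + 1)), c x * μ ^ x.val = 0 ↔ ∀ x, c (x + (p ^ a : ℕ)) = c x :=
  ⟨fun h x => periodic_of_sum_mul_pow_eq_zero hm hpm hμ hν c hc h x, sum_mul_pow_eq_zero_of_periodic hμ c⟩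

/-- The elements of order dividing `p` in `ℤ/p^{a+1}` are the multiples of `p^a`. [folklore] -/
private theorem exists_eq_nsmul_of_smul_eq_zero_pp [hp : Fact p.Prime] (d : ZMod (p ^ (a + 1))) (hd : p • d = 0) :
    ∃ j : ℕ, d = j • ((p ^ a : ℕ) : ZMod (p ^ (a + 1))) := by
  have h1 : ((p * d.val : ℕ) : ZMod (p ^ (a + 1))) = 0 := by
    rw [Nat.cast_mul, ZMod.natCast_zmod_val, ← nsmul_eq_mul]; exact hd
  rw [ZMod.natCast_eq_zero_iff] at h1
  have h2 : p * p ^ a ∣ p * d.val := by rw [← pow_succ']; exact h1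
  obtain ⟨j, hj⟩ := (mul_dvd_mul_iff_left hp.out.ne_zero).1 h2
  refine ⟨j, ?_⟩
  rw [nsmul_eq_mul, ← Nat.cast_mul, mul_comm, ← hj, ZMod.natCast_zmod_val]

/-- `p · p^a = 0` in `ℤ/p^{a+1}`. [folklore] -/
private theorem smul_natCast_pow_eq_zero_pp : p • ((p ^ a : ℕ) : ZMod (p ^ (a + 1))) = 0 := by
  rw [nsmul_eq_mul, ← Nat.cast_mul, ← pow_succ', ZMod.natCast_self]

/-- **Admissible-displacement form**: the relation `Σ_x c_x μˣ = 0` (coefficients in `ℚ(ζ_m)`, `p ∤ m`) holds iff `c(x + d) = c(x)` for every `x` and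
every `d ∈ ℤ/p^{a+1}` with `p·d = 0` (every element of the subgroup of order `p`). [cite: LamLeung2000, Thm. 2.2] -/
theorem sum_mul_pow_eq_zero_iff_forall_smul_eq_zero [hp : Fact p.Prime] (hm : 0 < m) (hpm : p.Coprime m)
    (hμ : IsPrimitiveRoot μ (p ^ (a + 1))) (hν : IsPrimitiveRoot ν m) (c : ZMod (p ^ (a + 1)) → ℂ) (hc : ∀ x, c x ∈ ℚ⟮ν⟯) :
    ∑ x : ZMod (p ^ (a + 1)), c x * μ ^ x.val = 0 ↔ ∀ x d : ZMod (p ^ (a + 1)), p • d = 0 → c (x + d) = c x := by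
  rw [sum_mul_pow_eq_zero_iff_periodic hm hpm hμ hν c hc]
  constructor
  · intro h x d hd
    obtain ⟨j, rfl⟩ := exists_eq_nsmul_of_smul_eq_zero_pp d hd
    clear hd
    induction j with
    | zero => rw [zero_nsmul, add_zero]
    | succ j ih => rw [succ_nsmul, ← add_assoc, h, ih]
  · intro h x
    exact h x _ smul_natCast_pow_eq_zero_pp

end Disjoint

/-! ## §2 Families of prime powers `q_i = p_i^{a_i+1}` with pairwise distinct primes: the product root and the field it generates -/

section Family

/-- For pairwise distinct primes `p_i`, exponents `a_i` and primitive `p_i^{a_i+1}`-th roots `μ_i`, `Π μ_i` is a primitive `(Π p_i^{a_i+1})`-th root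
of unity. [cite: Washington1997, Ch. 2 Thm. 2.5] -/
theorem isPrimitiveRoot_prod : ∀ (k : ℕ) (p a : Fin k → ℕ) (μ : Fin k → ℂ), (∀ i, (p i).Prime) → Function.Injective p →
    (∀ i, IsPrimitiveRoot (μ i) (p i ^ (a i + 1))) → IsPrimitiveRoot (∏ i, μ i) (∏ i, p i ^ (a i + 1))
  | 0, p, a, μ, _, _, _ => by
    rw [Fin.prod_univ_zero, Fin.prod_univ_zero]
    exact IsPrimitiveRoot.one
  | k + 1, p, a, μ, hp, hinj, hμ => by
    rw [Fin.prod_univ_succ, Fin.prod_univ_succ]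
    have htail := isPrimitiveRoot_prod k (fun i => p i.succ) (fun i => a i.succ) (fun i => μ i.succ) (fun i => hp i.succ)
      (fun i j h => Fin.succ_injective _ (hinj h)) (fun i => hμ i.succ)
    have hcop : (p 0 ^ (a 0 + 1)).Coprime (∏ i : Fin k, p i.succ ^ (a i.succ + 1)) :=
      Nat.Coprime.pow_left _ (Nat.Coprime.prod_right fun i _ => Nat.Coprime.pow_right _
        ((Nat.coprime_primes (hp 0) (hp i.succ)).2 fun h => Fin.succ_ne_zero i (hinj h).symm))
    exact isPrimitiveRoot_mul_of_coprime hcop (hμ 0) htail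

/-- `p_0^{a_0+1}` is prime to `Π_{i ≥ 1} p_i^{a_i+1}` for pairwise distinct primes. [folklore] -/
private theorem coprime_head_prod_tail_pp {k : ℕ} {p : Fin (k + 1) → ℕ} (a : Fin (k + 1) → ℕ) (hp : ∀ i, (p i).Prime)
    (hinj : Function.Injective p) : (p 0 ^ (a 0 + 1)).Coprime (∏ i : Fin k, p i.succ ^ (a i.succ + 1)) :=
  Nat.Coprime.pow_left _ (Nat.Coprime.prod_right fun i _ => Nat.Coprime.pow_right _
    ((Nat.coprime_primes (hp 0) (hp i.succ)).2 fun h => Fin.succ_ne_zero i (hinj h).symm))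

/-- `p_0` is prime to `Π_{i ≥ 1} p_i^{a_i+1}` for pairwise distinct primes. [folklore] -/
private theorem coprime_head_prime_prod_tail_pp {k : ℕ} {p : Fin (k + 1) → ℕ} (a : Fin (k + 1) → ℕ) (hp : ∀ i, (p i).Prime)
    (hinj : Function.Injective p) : (p 0).Coprime (∏ i : Fin k, p i.succ ^ (a i.succ + 1)) :=
  Nat.Coprime.prod_right fun i _ => Nat.Coprime.pow_right _
    ((Nat.coprime_primes (hp 0) (hp i.succ)).2 fun h => Fin.succ_ne_zero i (hinj h).symm)

/-- Every `μ_j` lies in `ℚ(Π_i μ_i)` (pairwise distinct primes). [cite: Washington1997, Ch. 2 Prop. 2.4] -/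
theorem mem_adjoin_prod : ∀ (k : ℕ) (p a : Fin k → ℕ) (μ : Fin k → ℂ), (∀ i, (p i).Prime) → Function.Injective p →
    (∀ i, IsPrimitiveRoot (μ i) (p i ^ (a i + 1))) → ∀ j, μ j ∈ ℚ⟮∏ i, μ i⟯
  | 0, _, _, _, _, _, _, j => j.elim0
  | k + 1, p, a, μ, hp, hinj, hμ, j => by
    rw [Fin.prod_univ_succ]
    have hinj' : Function.Injective (fun i : Fin k => p i.succ) := fun i j h => Fin.succ_injective _ (hinj h)
    have htail := isPrimitiveRoot_prod k (fun i => p i.succ) (fun i => a i.succ) (fun i => μ i.succ) (fun i => hp i.succ) hinj'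
      (fun i => hμ i.succ)
    have hcop := coprime_head_prod_tail_pp a hp hinj
    refine Fin.cases ?_ (fun i => ?_) j
    · exact mem_adjoin_mul_of_coprime_left (pow_pos (hp 0).pos _) hcop (hμ 0) htail
    · have hi := mem_adjoin_prod k (fun i => p i.succ) (fun i => a i.succ) (fun i => μ i.succ) (fun i => hp i.succ) hinj'
        (fun i => hμ i.succ) i
      have hle : ℚ⟮∏ i : Fin k, μ i.succ⟯ ≤ ℚ⟮μ 0 * ∏ i : Fin k, μ i.succ⟯ :=
        adjoin_simple_le_iff.mpr (mem_adjoin_mul_of_coprime_right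
          (Finset.prod_pos fun i _ => pow_pos (hp i.succ).pos _) hcop (hμ 0) htail)
      exact hle hi

end Family

/-! ## §3 Vanishing sums over `ℤ/p₁^{a₁+1} × ⋯ × ℤ/p_k^{a_k+1}` (any conductor): the alternating-difference criterion along the subgroups of order `p_i` -/

section Vanishing

/-- Splitting of the alternating sum along the first coordinate. [folklore] -/
private theorem alternatingSum_cons_pp {k : ℕ} {p a : Fin (k + 1) → ℕ} (f : (Π i, ZMod (p i ^ (a i + 1))) → ℚ)
    (b d : ZMod (p 0 ^ (a 0 + 1))) (y e : Π i : Fin k, ZMod (p i.succ ^ (a i.succ + 1))) :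
    ∑ ε : Fin (k + 1) → Bool, (∏ i, (if ε i then (-1 : ℚ) else 1)) *
        f (fun i => if ε i then (Fin.cons b y : Π i, ZMod (p i ^ (a i + 1))) i + (Fin.cons d e : Π i, ZMod (p i ^ (a i + 1))) i
          else (Fin.cons b y : Π i, ZMod (p i ^ (a i + 1))) i) =
      ∑ ε : Fin k → Bool, (∏ i, (if ε i then (-1 : ℚ) else 1)) *
          f (Fin.cons b (fun i => if ε i then y i + e i else y i)) -
        ∑ ε : Fin k → Bool, (∏ i, (if ε i then (-1 : ℚ) else 1)) *
          f (Fin.cons (b + d) (fun i => if ε i then y i + e i else y i)) := by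
  rw [← Fintype.sum_equiv (Fin.consEquiv fun _ : Fin (k + 1) => Bool)
    (fun bε => (∏ i, (if (Fin.cons bε.1 bε.2 : Fin (k + 1) → Bool) i then (-1 : ℚ) else 1)) *
      f (fun i => if (Fin.cons bε.1 bε.2 : Fin (k + 1) → Bool) i then
        (Fin.cons b y : Π i, ZMod (p i ^ (a i + 1))) i + (Fin.cons d e : Π i, ZMod (p i ^ (a i + 1))) i
        else (Fin.cons b y : Π i, ZMod (p i ^ (a i + 1))) i))
    _ (fun _ => rfl), Fintype.sum_prod_type, Fintype.sum_bool]
  have hpt : ∀ (bb : Bool) (ε : Fin k → Bool),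
      (fun i => if (Fin.cons bb ε : Fin (k + 1) → Bool) i then
        (Fin.cons b y : Π i, ZMod (p i ^ (a i + 1))) i + (Fin.cons d e : Π i, ZMod (p i ^ (a i + 1))) i
        else (Fin.cons b y : Π i, ZMod (p i ^ (a i + 1))) i) =
      (Fin.cons (if bb then b + d else b) (fun i => if ε i then y i + e i else y i) : Π i, ZMod (p i ^ (a i + 1))) := by
    intro bb ε
    funext i
    refine Fin.cases ?_ (fun j => ?_) i
    · simp only [Fin.cons_zero]
    · simp only [Fin.cons_succ]
  have hsign : ∀ (bb : Bool) (ε : Fin k → Bool),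
      (∏ i, (if (Fin.cons bb ε : Fin (k + 1) → Bool) i then (-1 : ℚ) else 1)) =
        (if bb then (-1 : ℚ) else 1) * ∏ i, (if ε i then (-1 : ℚ) else 1) := by
    intro bb ε
    rw [Fin.prod_univ_succ]
    simp only [Fin.cons_zero, Fin.cons_succ]
  simp_rw [hpt, hsign]
  simp only [ite_true, ite_false, Bool.false_eq_true, one_mul]
  rw [add_comm, sub_eq_add_neg, ← Finset.sum_neg_distrib]
  congr 1
  exact Finset.sum_congr rfl fun ε _ => by ring

/-- **Vanishing sums of roots of unity of ANY order — the alternating-difference criterion along the subgroups of prime order** (Rédei ∕ de Bruijn ∕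
Schoenberg, in the form of [LamLeung2000] Thm. 2.2, rational coefficients).  For pairwise distinct primes `p_i`, exponents `a_i`, primitive
`p_i^{a_i+1}`-th roots of unity `μ_i ∈ ℂ` and `f : ℤ/p₁^{a₁+1} × ⋯ × ℤ/p_k^{a_k+1} → ℚ` (so `Π_i μ_i^{x_i}` runs through ALL roots of unity of order
dividing `n = Π p_i^{a_i+1}`, by the Chinese remainder theorem):

  `Σ_x f(x) · Π_i μ_i^{x_i} = 0  ⟺  Σ_{ε ∈ {0,1}^k} (−1)^{|ε|} f(x + ε·d) = 0` for all base points `x` and all displacements `d` with `p_i·d_i = 0`,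

i.e. every `k`-th MIXED DIFFERENCE of `f` ALONG THE SUBGROUPS `P_i` OF ORDER `p_i` vanishes (`k = 1`: `f` constant on the cosets of `P₁`, the tree's
`PrimePow.sum_mul_pow_eq_zero_iff_periodic`; squarefree `n`: the neighbour's `sum_mul_prod_pow_eq_zero_iff_forall_alternatingSum_eq_zero`; in
general `f` lies in the span of the `P_i`-coset indicators — `ker φ = Σ_i ℤG·σ(P_i)` — over `ℚ`).  Proof by induction on `k`: split off the first
coordinate; the inner sums lie in `ℚ(μ₂⋯μ_k) = ℚ(ζ_{n/p₁^{a₁+1}})`, and by linear disjointness (`sum_mul_pow_eq_zero_iff_forall_smul_eq_zero`) the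
outer relation holds iff the inner sums are `p₁^{a₁}`-periodic, i.e. iff every row difference `f(b + d₁, ·) − f(b, ·)` (`p₁·d₁ = 0`) is a relation in
`k − 1` variables. [cite: LamLeung2000, Thm. 2.2 (cf. Rédei Hilfssatz 4, de Bruijn Thm. 1, Schoenberg Thm. 1) and Thm. 3.3] [cite: ConwayJones1976, Thm. 1] -/
theorem sum_mul_prod_pow_eq_zero_iff_forall_alternatingSum_eq_zero :
    ∀ (k : ℕ) (p a : Fin k → ℕ) [∀ i, NeZero (p i ^ (a i + 1))] (μ : Fin k → ℂ), (∀ i, (p i).Prime) → Function.Injective p →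
      (∀ i, IsPrimitiveRoot (μ i) (p i ^ (a i + 1))) → ∀ f : (Π i, ZMod (p i ^ (a i + 1))) → ℚ,
      (∑ x : (Π i, ZMod (p i ^ (a i + 1))), algebraMap ℚ ℂ (f x) * ∏ i, μ i ^ (x i).val = 0 ↔
        ∀ x d : (Π i, ZMod (p i ^ (a i + 1))), (∀ i, p i • d i = 0) →
          ∑ ε : Fin k → Bool, (∏ i, (if ε i then (-1 : ℚ) else 1)) * f (fun i => if ε i then x i + d i else x i) = 0)
  | 0, p, a, _, μ, _, _, _, f => by
    simp only [Fintype.sum_unique, Finset.univ_eq_empty, Finset.prod_empty, mul_one, one_mul, map_eq_zero]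
    constructor
    · intro h x d _
      convert h using 2
    · intro h
      have h0 := h default default (fun i => i.elim0)
      convert h0 using 2
  | k + 1, p, a, inst, μ, hp, hinj, hμ, f => by
    haveI : Fact (p 0).Prime := ⟨hp 0⟩
    have hinj' : Function.Injective (fun i : Fin k => p i.succ) := fun i j h => Fin.succ_injective _ (hinj h)
    -- the tail root `ν = μ₂⋯μ_k`, a primitive `m`-th root, `m = Π_{i≥2} p_i^{a_i+1}` prime to `p₁`
    have hν := isPrimitiveRoot_prod k (fun i => p i.succ) (fun i => a i.succ) (fun i => μ i.succ) (fun i => hp i.succ) hinj'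
      (fun i => hμ i.succ)
    have hm : 0 < ∏ i : Fin k, p i.succ ^ (a i.succ + 1) := Finset.prod_pos fun i _ => pow_pos (hp i.succ).pos _
    have hcop := coprime_head_prime_prod_tail_pp a hp hinj
    have hmem : ∀ j : Fin k, μ j.succ ∈ ℚ⟮∏ i : Fin k, μ i.succ⟯ :=
      mem_adjoin_prod k (fun i => p i.succ) (fun i => a i.succ) (fun i => μ i.succ) (fun i => hp i.succ) hinj' (fun i => hμ i.succ)
    -- the induction hypothesis for the row differences
    have IH := fun g => sum_mul_prod_pow_eq_zero_iff_forall_alternatingSum_eq_zero k (fun i => p i.succ) (fun i => a i.succ)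
      (fun i => μ i.succ) (fun i => hp i.succ) hinj' (fun i => hμ i.succ) g
    -- inner sums
    set c : ZMod (p 0 ^ (a 0 + 1)) → ℂ := fun b => ∑ y : (Π i : Fin k, ZMod (p i.succ ^ (a i.succ + 1))),
      algebraMap ℚ ℂ (f (Fin.cons b y)) * ∏ i, μ i.succ ^ (y i).val with hc
    have hcmem : ∀ b, c b ∈ ℚ⟮∏ i : Fin k, μ i.succ⟯ := fun b =>
      sum_mem fun y _ => mul_mem (IntermediateField.algebraMap_mem _ _) (prod_mem fun i _ => pow_mem (hmem i) _)
    -- Step 1: the total sum, split along the first coordinate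
    have hsplit : ∑ x : (Π i, ZMod (p i ^ (a i + 1))), algebraMap ℚ ℂ (f x) * ∏ i, μ i ^ (x i).val =
        ∑ b : ZMod (p 0 ^ (a 0 + 1)), c b * μ 0 ^ b.val := by
      rw [← Fintype.sum_equiv (Fin.consEquiv fun i => ZMod (p i ^ (a i + 1)))
        (fun by_ => algebraMap ℚ ℂ (f (Fin.cons by_.1 by_.2)) *
          ∏ i, μ i ^ ((Fin.cons by_.1 by_.2 : Π i, ZMod (p i ^ (a i + 1))) i).val)
        _ (fun _ => rfl), Fintype.sum_prod_type]
      refine Finset.sum_congr rfl fun b _ => ?_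
      rw [hc, Finset.sum_mul]
      refine Finset.sum_congr rfl fun y _ => ?_
      rw [Fin.prod_univ_succ]
      simp only [Fin.cons_zero, Fin.cons_succ]
      ring
    -- Step 2: linear disjointness — the total sum vanishes iff the inner sums are `p₁^{a₁}`-periodic
    have hstep2 : ∑ b : ZMod (p 0 ^ (a 0 + 1)), c b * μ 0 ^ b.val = 0 ↔
        ∀ b d : ZMod (p 0 ^ (a 0 + 1)), p 0 • d = 0 → c (b + d) = c b :=
      sum_mul_pow_eq_zero_iff_forall_smul_eq_zero hm hcop (hμ 0) hν c hcmem
    -- Step 3: `c (b + d) = c b` iff the row difference `f(b + d,·) − f(b,·)` is a relation in `k` variables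
    have hstep3 : ∀ b d, c (b + d) = c b ↔
        ∑ y : (Π i : Fin k, ZMod (p i.succ ^ (a i.succ + 1))), algebraMap ℚ ℂ (f (Fin.cons (b + d) y) - f (Fin.cons b y)) *
          ∏ i, μ i.succ ^ (y i).val = 0 := by
      intro b d
      rw [← sub_eq_zero, hc]
      simp only [map_sub, sub_mul, Finset.sum_sub_distrib]
    -- Step 4: alternating sums of a row difference
    have hstep4 : ∀ b d (y e : Π i : Fin k, ZMod (p i.succ ^ (a i.succ + 1))),
        ∑ ε : Fin k → Bool, (∏ i, (if ε i then (-1 : ℚ) else 1)) *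
            (fun z : (Π i : Fin k, ZMod (p i.succ ^ (a i.succ + 1))) => f (Fin.cons (b + d) z) - f (Fin.cons b z))
              (fun i => if ε i then y i + e i else y i) =
          ∑ ε : Fin k → Bool, (∏ i, (if ε i then (-1 : ℚ) else 1)) * f (Fin.cons (b + d) (fun i => if ε i then y i + e i else y i)) -
            ∑ ε : Fin k → Bool, (∏ i, (if ε i then (-1 : ℚ) else 1)) *
              f (Fin.cons b (fun i => if ε i then y i + e i else y i)) := by
      intro b d y e
      rw [← Finset.sum_sub_distrib]
      refine Finset.sum_congr rfl fun ε _ => ?_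
      simp only
      ring
    -- assemble
    rw [hsplit, hstep2]
    simp_rw [hstep3]
    constructor
    · intro h x d hd
      rw [← Fin.cons_self_tail x, ← Fin.cons_self_tail d, alternatingSum_cons_pp]
      have hx := (IH _).1 (h (x 0) (d 0) (hd 0)) (Fin.tail x) (Fin.tail d) (fun i => hd i.succ)
      rw [hstep4] at hx
      linear_combination (-1 : ℚ) * hx
    · intro h b d hd
      refine (IH _).2 fun y e he => ?_
      rw [hstep4]
      have h1 := h (Fin.cons b y) (Fin.cons d e) (Fin.cases hd he)
      rw [alternatingSum_cons_pp] at h1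
      linear_combination (-1 : ℚ) * h1

end Vanishing

end Literature.NumberTheory.NumberFields.VanishingSumsPrimePowers
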